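import Summits.SmoothPoincare4.SmoothPoincare4.Theses.InformationMetricHadamard
import Literature.Geometry.Manifold.InverseFunctionTheorem
import Literature.Geometry.Lorentzian.Isometry

/-!
# Far collar package (groundwork for crux `InformationMetricHadamard.C0AhRecognition`)

Collar bookkeeping for an end collar `Ψ : N × (0,1) → W⁵` over a compact 4-manifold `N` which is
smooth and injective on `N × (0,1)`, satisfies the closure clause, but is known to be IMMERSIVE ONLY
FAR OUT, on `N × (0,t₀)` (which is all the crux `C0AhRecognition` provides: stub A of line `Sketch`,
landed as `Theorems/InformationMetricHadamardC0AhRecognitionStubFarCollarImmersive.lean`), and whose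
deep points are metrically far (the conclusion of stub C of line `Sketch`, hypothesis `hfar`).
With `K_t := (Ψ(N × (0,t)))ᶜ`:

* `isOpen_image_collar_far`, `isOpen_image_far'` — `Ψ` is open on `N × (0,t₀)`; far parts
  `Ψ(N × (0,t))`, `t ≤ t₀`, are open (inverse function theorem, `4 + 1 = 5`);
* `closure_image_far'` — `cl Ψ(N × (0,t)) = Ψ(N × (0,t])` for EVERY `t ∈ (0,1)` (no immersivity:
  compactness of `N × [t',t]` plus `hfar` to exclude limits of ever deeper points);
* `frontier_far_compl'` — `∂K_t = Ψ(N × {t})` for `t ≤ t₀`;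
* `interior_far_compl_nonempty` — `(interior K_t).Nonempty` for `t < t₀` (`N ≠ ∅`).

Pattern: `Theorems/InformationMetricHadamardAhHadamardFillingStubCollarPackage.lean` (global
immersivity, homotopy-sphere carrier); here general `N` and far-only immersivity. Everything proved.
-/

noncomputable section

-- the prescribed namespace `Summit.<P>.<Sub>.…` duplicates `SmoothPoincare4` (P = Sub)
set_option linter.dupNamespace false

open scoped Manifold ContDiff Topology ENNReal NNReal
open Set Function

namespace Summit.SmoothPoincare4.SmoothPoincare4.Cruxes.C0AhRecognition.Prep

open Literature.Geometry.Lorentzian (PseudoRiemannianMetric)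

/-- Model space `ℝ⁴` of the cross-section. -/
local notation "E4" => EuclideanSpace ℝ (Fin 4)
/-- Model space `ℝ⁵` of the filling. -/
local notation "E5" => EuclideanSpace ℝ (Fin 5)

variable {N : Type} [TopologicalSpace N] [ChartedSpace E4 N] [IsManifold (𝓡 4) ∞ N]
  {W : Type} [TopologicalSpace W] [ChartedSpace E5 W] [IsManifold (𝓡 5) ∞ W] (Ψ : N × ℝ → W)

/-- **The collar map is open where it is immersive**: if `Ψ` is smooth on `N × (0,1)` and has
injective differential on `N × (0,t₀)`, `t₀ ≤ 1`, then `Ψ` maps open subsets of `N × (0,t₀)` to open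
sets (inverse function theorem, `4 + 1 = 5`). [folklore] -/
theorem isOpen_image_collar_far
    (hsm : ContMDiffOn ((𝓡 4).prod 𝓘(ℝ, ℝ)) (𝓡 5) ∞ Ψ (univ ×ˢ Ioo (0 : ℝ) 1))
    {t₀ : ℝ} (ht₀ : t₀ ≤ 1)
    (himm : ∀ (y : N) (l : ℝ), l ∈ Ioo (0 : ℝ) t₀ →
      Injective (mfderiv ((𝓡 4).prod 𝓘(ℝ, ℝ)) (𝓡 5) Ψ (y, l)))
    {V : Set (N × ℝ)} (hV : IsOpen V) (hVΩ : V ⊆ univ ×ˢ Ioo (0 : ℝ) t₀) :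
    IsOpen (Ψ '' V) := by
  have hΩo : IsOpen (univ ×ˢ Ioo (0 : ℝ) t₀ : Set (N × ℝ)) := isOpen_univ.prod isOpen_Ioo
  have hsub : (univ ×ˢ Ioo (0 : ℝ) t₀ : Set (N × ℝ)) ⊆ univ ×ˢ Ioo (0 : ℝ) 1 :=
    prod_mono Subset.rfl (Ioo_subset_Ioo_right ht₀)
  have hsm₀ : ContMDiffOn ((𝓡 4).prod 𝓘(ℝ, ℝ)) (𝓡 5) ∞ Ψ (univ ×ˢ Ioo (0 : ℝ) t₀) := hsm.mono hsub
  have hdim : Module.finrank ℝ (E4 × ℝ) = Module.finrank ℝ E5 := by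
    rw [Module.finrank_prod, finrank_euclideanSpace_fin, finrank_euclideanSpace_fin,
      Module.finrank_self]
  have hloc : IsLocalDiffeomorphOn ((𝓡 4).prod 𝓘(ℝ, ℝ)) (𝓡 5) ∞ Ψ (univ ×ˢ Ioo (0 : ℝ) t₀) := by
    rintro ⟨x, hx⟩
    have hx' : Injective (mfderiv ((𝓡 4).prod 𝓘(ℝ, ℝ)) (𝓡 5) Ψ x) := by
      obtain ⟨y, l⟩ := x
      exact himm y l hx.2
    set L : (E4 × ℝ) ≃ₗ[ℝ] E5 :=
      Literature.Geometry.Lorentzian.mfderivEquivOfInjective (I := 𝓡 5)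
        (I' := (𝓡 4).prod 𝓘(ℝ, ℝ)) Ψ x hx' hdim with hL
    refine Literature.Geometry.Manifold.isLocalDiffeomorphAt_of_mfderiv (by simp) hΩo hx hsm₀
      L.toContinuousLinearEquiv ?_
    ext u
    rfl
  rw [isOpen_iff_mem_nhds]
  rintro _ ⟨x, hxV, rfl⟩
  rw [← hloc.isLocalHomeomorphOn.map_nhds_eq (hVΩ hxV)]
  exact Filter.image_mem_map (hV.mem_nhds hxV)

/-- Far parts `Ψ(N × (0,t))`, `t ≤ t₀`, are open. [folklore] -/
theorem isOpen_image_far'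
    (hsm : ContMDiffOn ((𝓡 4).prod 𝓘(ℝ, ℝ)) (𝓡 5) ∞ Ψ (univ ×ˢ Ioo (0 : ℝ) 1))
    {t₀ : ℝ} (ht₀ : t₀ ≤ 1)
    (himm : ∀ (y : N) (l : ℝ), l ∈ Ioo (0 : ℝ) t₀ →
      Injective (mfderiv ((𝓡 4).prod 𝓘(ℝ, ℝ)) (𝓡 5) Ψ (y, l)))
    {t : ℝ} (ht : t ≤ t₀) : IsOpen (Ψ '' (univ ×ˢ Ioo (0 : ℝ) t)) :=
  isOpen_image_collar_far Ψ hsm ht₀ himm (isOpen_univ.prod isOpen_Ioo)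
    (prod_mono Subset.rfl (Ioo_subset_Ioo_right ht))

omit [ChartedSpace E4 N] [IsManifold (𝓡 4) ∞ N] in
/-- **Closure of a far part**, without immersivity: `cl Ψ(N × (0,t)) = Ψ(N × (0,t])` for every
`t ∈ (0,1)`, provided `N` is compact, `Ψ` is continuous and injective on the strip, the closure
clause holds, and deep points are metrically far from any base point (`hfar`, stub C of line
`Sketch`): a limit of points of bounded depth is a collar point of height `≤ t` by compactness of
`N × [t', t]`; a limit of ever deeper points would be within distance `1` of points at distance `> 1`.
[folklore] -/
theorem closure_image_far' [CompactSpace N] [T2Space W] [RegularSpace W]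
    (G : PseudoRiemannianMetric (𝓡 5) ∞ E5 (TangentSpace (𝓡 5) : W → Type _)) (hG : G.IsRiemannian)
    (hcont : ContinuousOn Ψ (univ ×ˢ Ioo (0 : ℝ) 1))
    (hinj : InjOn Ψ (univ ×ˢ Ioo (0 : ℝ) 1))
    (hcl : ∀ t ∈ Ioo (0 : ℝ) 1,
      closure (Ψ '' (univ ×ˢ Ioo (0 : ℝ) t)) ⊆ Ψ '' (univ ×ˢ Ioo (0 : ℝ) 1))
    (hfar : ∀ (x₀ : W) (R : NNReal), ∃ t ∈ Ioo (0 : ℝ) 1, ∀ (y : N) (l : ℝ), l ∈ Ioo (0 : ℝ) t →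
      (R : ℝ≥0∞) < G.edist hG x₀ (Ψ (y, l)))
    {t : ℝ} (ht : t ∈ Ioo (0 : ℝ) 1) :
    closure (Ψ '' (univ ×ˢ Ioo (0 : ℝ) t)) = Ψ '' (univ ×ˢ Ioc (0 : ℝ) t) := by
  apply Subset.antisymm
  · intro p hp
    obtain ⟨q, hqΩ, rfl⟩ := hcl t ht hp
    by_contra hne
    have hqt : t < q.2 := by
      by_contra h
      exact hne ⟨q, ⟨mem_univ _, hqΩ.2.1, not_lt.1 h⟩, rfl⟩
    -- deep points are at distance `> 1` from `p = Ψ q`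
    obtain ⟨t', ht', hdeep⟩ := hfar (Ψ q) 1
    -- split the far part at height `t'`
    have hsplit : Ψ '' (univ ×ˢ Ioo (0 : ℝ) t) ⊆
        Ψ '' (univ ×ˢ Ioo (0 : ℝ) t') ∪ Ψ '' (univ ×ˢ Icc t' t) := by
      rintro _ ⟨x, hx, rfl⟩
      rcases lt_or_ge x.2 t' with h | h
      · exact Or.inl ⟨x, ⟨mem_univ _, hx.2.1, h⟩, rfl⟩
      · exact Or.inr ⟨x, ⟨mem_univ _, h, hx.2.2.le⟩, rfl⟩
    have hp' := closure_mono hsplit hp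
    rw [closure_union] at hp'
    rcases hp' with h1 | h2
    · -- the distance-`1` ball about `Ψ q` misses the deep part
      have hball : {y : W | G.edist hG (Ψ q) y < 1} ∈ 𝓝 (Ψ q) :=
        PseudoRiemannianMetric.setOf_edist_lt_mem_nhds hG (Ψ q) one_pos
      rw [mem_closure_iff_nhds] at h1
      obtain ⟨y, hyB, ⟨x, hx, rfl⟩⟩ := h1 _ hball
      have hlt : G.edist hG (Ψ q) (Ψ x) < 1 := hyB
      have hgt := hdeep x.1 x.2 hx.2
      simp only [ENNReal.coe_one, Prod.mk.eta] at hgt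
      exact lt_irrefl _ (hgt.trans hlt)
    · -- a compact piece of bounded depth is closed
      have hKc : IsCompact (Ψ '' (univ ×ˢ Icc t' t)) := by
        refine (isCompact_univ.prod isCompact_Icc).image_of_continuousOn (hcont.mono ?_)
        exact prod_mono Subset.rfl fun l hl ↦ ⟨ht'.1.trans_le hl.1, hl.2.trans_lt ht.2⟩
      rw [hKc.isClosed.closure_eq] at h2
      obtain ⟨x, hx, hxq⟩ := h2
      have hxΩ : x ∈ (univ ×ˢ Ioo (0 : ℝ) 1 : Set (N × ℝ)) :=
        ⟨mem_univ _, ht'.1.trans_le hx.2.1, hx.2.2.trans_lt ht.2⟩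
      have heq : x = q := hinj hxΩ hqΩ hxq
      have : x.2 ≤ t := hx.2.2
      rw [heq] at this
      exact lt_irrefl _ (hqt.trans_le this)
  · rintro _ ⟨x, hx, rfl⟩
    have hxΩ : x ∈ (univ ×ˢ Ioo (0 : ℝ) 1 : Set (N × ℝ)) :=
      ⟨mem_univ _, hx.2.1, lt_of_le_of_lt hx.2.2 ht.2⟩
    have hΩo : IsOpen (univ ×ˢ Ioo (0 : ℝ) 1 : Set (N × ℝ)) := isOpen_univ.prod isOpen_Ioo
    have hxcl : x ∈ closure (univ ×ˢ Ioo (0 : ℝ) t : Set (N × ℝ)) := by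
      rw [closure_prod_eq, closure_univ, closure_Ioo ht.1.ne]
      exact ⟨mem_univ _, hx.2.1.le, hx.2.2⟩
    have hcx : ContinuousWithinAt Ψ (univ ×ˢ Ioo (0 : ℝ) t) x :=
      (hcont.continuousAt (hΩo.mem_nhds hxΩ)).continuousWithinAt
    exact hcx.mem_closure_image hxcl

/-- **The frontier of a far complement is the slice**: `∂K_t = Ψ(N × {t})` for `t ≤ t₀`
(`K_t = (Ψ(N × (0,t)))ᶜ`), under far immersivity (openness) and the hypotheses of
`closure_image_far'`. [folklore] -/
theorem frontier_far_compl' [CompactSpace N] [T2Space W] [RegularSpace W]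
    (G : PseudoRiemannianMetric (𝓡 5) ∞ E5 (TangentSpace (𝓡 5) : W → Type _)) (hG : G.IsRiemannian)
    (hsm : ContMDiffOn ((𝓡 4).prod 𝓘(ℝ, ℝ)) (𝓡 5) ∞ Ψ (univ ×ˢ Ioo (0 : ℝ) 1))
    (hinj : InjOn Ψ (univ ×ˢ Ioo (0 : ℝ) 1))
    (hcl : ∀ t ∈ Ioo (0 : ℝ) 1,
      closure (Ψ '' (univ ×ˢ Ioo (0 : ℝ) t)) ⊆ Ψ '' (univ ×ˢ Ioo (0 : ℝ) 1))
    {t₀ : ℝ} (ht₀ : t₀ ≤ 1)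
    (himm : ∀ (y : N) (l : ℝ), l ∈ Ioo (0 : ℝ) t₀ →
      Injective (mfderiv ((𝓡 4).prod 𝓘(ℝ, ℝ)) (𝓡 5) Ψ (y, l)))
    (hfar : ∀ (x₀ : W) (R : NNReal), ∃ t ∈ Ioo (0 : ℝ) 1, ∀ (y : N) (l : ℝ), l ∈ Ioo (0 : ℝ) t →
      (R : ℝ≥0∞) < G.edist hG x₀ (Ψ (y, l)))
    {t : ℝ} (ht : t ∈ Ioo (0 : ℝ) 1) (htt₀ : t ≤ t₀) :
    frontier (Ψ '' (univ ×ˢ Ioo (0 : ℝ) t))ᶜ = Ψ '' (univ ×ˢ {t}) := by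
  rw [frontier_compl, frontier, closure_image_far' Ψ G hG hsm.continuousOn hinj hcl hfar ht,
    (isOpen_image_far' Ψ hsm ht₀ himm htt₀).interior_eq]
  ext y
  constructor
  · rintro ⟨⟨x, hx, rfl⟩, hnot⟩
    refine ⟨x, ⟨mem_univ _, ?_⟩, rfl⟩
    rcases hx.2.2.lt_or_eq with hlt | heq
    · exact absurd ⟨x, ⟨mem_univ _, hx.2.1, hlt⟩, rfl⟩ hnot
    · exact heq
  · rintro ⟨x, hx, rfl⟩
    have hx2 : x.2 = t := hx.2
    refine ⟨⟨x, ⟨mem_univ _, by rw [hx2]; exact ht.1, by rw [hx2]⟩, rfl⟩, ?_⟩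
    rintro ⟨x', hx', heq⟩
    have hxΩ : x ∈ (univ ×ˢ Ioo (0 : ℝ) 1 : Set (N × ℝ)) :=
      ⟨mem_univ _, by rw [hx2]; exact ht.1, by rw [hx2]; exact ht.2⟩
    have := hinj ⟨mem_univ _, hx'.2.1, hx'.2.2.trans ht.2⟩ hxΩ heq
    have h1 : x'.2 < t := hx'.2.2
    rw [this, hx2] at h1
    exact lt_irrefl _ h1

/-- **The far complement has nonempty interior**: for `t < t₀` and `N ≠ ∅`, the open shallow band
`Ψ(N × (t, t₀))` lies in `K_t` (injectivity), hence in its interior. [folklore] -/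
theorem interior_far_compl_nonempty [Nonempty N]
    (hsm : ContMDiffOn ((𝓡 4).prod 𝓘(ℝ, ℝ)) (𝓡 5) ∞ Ψ (univ ×ˢ Ioo (0 : ℝ) 1))
    (hinj : InjOn Ψ (univ ×ˢ Ioo (0 : ℝ) 1))
    {t₀ : ℝ} (ht₀ : t₀ ≤ 1)
    (himm : ∀ (y : N) (l : ℝ), l ∈ Ioo (0 : ℝ) t₀ →
      Injective (mfderiv ((𝓡 4).prod 𝓘(ℝ, ℝ)) (𝓡 5) Ψ (y, l)))
    {t : ℝ} (ht : 0 < t) (htt₀ : t < t₀) :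
    (interior (Ψ '' (univ ×ˢ Ioo (0 : ℝ) t))ᶜ).Nonempty := by
  obtain ⟨y⟩ := ‹Nonempty N›
  have hU : IsOpen (Ψ '' (univ ×ˢ Ioo t t₀)) :=
    isOpen_image_collar_far Ψ hsm ht₀ himm (isOpen_univ.prod isOpen_Ioo)
      (prod_mono Subset.rfl (Ioo_subset_Ioo_left ht.le))
  have hUK : Ψ '' (univ ×ˢ Ioo t t₀) ⊆ (Ψ '' (univ ×ˢ Ioo (0 : ℝ) t))ᶜ := by
    rintro _ ⟨x, hx, rfl⟩ ⟨x', hx', heq⟩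
    have h := hinj ⟨mem_univ _, hx'.2.1, hx'.2.2.trans (htt₀.trans_le ht₀)⟩
      ⟨mem_univ _, ht.trans hx.2.1, hx.2.2.trans_le ht₀⟩ heq
    have h1 : x'.2 < t := hx'.2.2
    have h2 : t < x.2 := hx.2.1
    rw [h] at h1
    exact lt_irrefl _ (h2.trans h1)
  set l : ℝ := (t + t₀) / 2 with hl
  have hl1 : t < l := by rw [hl]; linarith
  have hl2 : l < t₀ := by rw [hl]; linarith
  exact ⟨Ψ (y, l), interior_mono hUK (hU.interior_eq.symm ▸ ⟨(y, l), ⟨mem_univ _, hl1, hl2⟩, rfl⟩)⟩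

end Summit.SmoothPoincare4.SmoothPoincare4.Cruxes.C0AhRecognition.Prep

end
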